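import Mathlib
import Literature.Analysis.FluidPDE.AdaptedBackwardKernel
import Literature.Analysis.FluidPDE.SelfSimilar
import Literature.Analysis.FluidPDE.PineauVicolRSS
import Summits.NavierStokesRegularity.NavierStokesRegularity.Theses.AdaptedFrequency

/-!
# Sketch — first lemmas of three crux ideas for `AdaptedFrequency.FrequencyRigidity`
(stmt-NavierStokesRegularity-2955; planner-cruxidea-…-2955-2-0, round 1, ideator 2).

Only STATEMENTS (`def … : Prop`) over existing declarations; nothing is proved here.

* `IsWitness`, `WitnessForm`      — the ∃-body of the crux restated with the tree's notions
                                     (`IsAdaptedBackwardKernel`, `IsGaussianComparable`, `adaptedEnstrophy`,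
                                     `adaptedFrequency`, `HasTypeITimeDecay`).
* card `two-ended-pinning`:         `TwoEndedPinning` (Λ₀ = 2 and H = A(−t)⁻² are FORCED), `WitnessVorticityBound`.
* card `moving-adjoint-bernoulli`:  `MovingAdjointBernoulli` (d/dt ⟨½|v|²+q⟩_K = −ν H + ⟨∂ₜq⟩_K),
                                     `SecularPressureWork` (its integrated form on a witness).
* card `kernel-fading-memory`:      `IsWindowAdjointKernel`, `KernelMerging`, `ComparableKernelUnique`,
                                     `RSSGivesConstantFrequency` (the disprover's converse: a middle-α RSS profile
                                     with a comparable kernel is a witness).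
-/

namespace Summit.NavierStokesRegularity.NavierStokesRegularity.Cruxes.FrequencyRigidity

open MeasureTheory Set Function Filter
open scoped Topology

open Literature.Analysis.FluidPDE

local notation "E³" => EuclideanSpace ℝ (Fin 3)

/-! ### The witness class of the crux -/

/-- A WITNESS against `FrequencyRigidity`: the ∃-body of the crux, with the five kernel clauses and the
Gaussian comparability folded into the tree's `IsAdaptedBackwardKernel` / `IsGaussianComparable`
(pole `(T, x₀) = (0, 0)`, time set `Iio 0`) and `H`, `Λ` folded into `adaptedEnstrophy`,
`adaptedFrequency … 0`. -/
def IsWitness (ν C Λ₀ : ℝ) (v : ℝ → E³ → E³) (q : ℝ → E³ → ℝ) (K : ℝ → E³ → ℝ) : Prop :=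
  0 < ν ∧ IsClassicalNSSolutionOn (Iio 0) ν 0 v q ∧ HasTypeITimeDecay C v ∧
    IsAdaptedBackwardKernel ν v (Iio 0) 0 0 K ∧ IsGaussianComparable K (Iio 0) 0 0 ∧
    (∀ t < 0, 0 < adaptedEnstrophy v K t) ∧ (∀ t < 0, adaptedFrequency v K 0 t = Λ₀)

/-- Bookkeeping claim (definitional unfoldings `isAdaptedBackwardKernel_iff`,
`isGaussianComparable_iff_fin_three`, `adaptedEnstrophy_apply`, `adaptedFrequency_apply`):
the crux is literally `¬ ∃ witness`. -/
def WitnessForm : Prop :=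
  (¬ ∃ (ν C Λ₀ : ℝ) (v : ℝ → E³ → E³) (q : ℝ → E³ → ℝ) (K : ℝ → E³ → ℝ), IsWitness ν C Λ₀ v q K) ↔
    Summit.NavierStokesRegularity.NavierStokesRegularity.Theses.AdaptedFrequency.FrequencyRigidity

/-! ### Card `two-ended-pinning` -/

/-- Regularity input (KNSS-type smoothing for Type-I ancient flows, after Galilei normalisation by the
CENTRED kernel): a witness has the scale-invariant vorticity bound `‖curl v(t,x)‖ ≤ C′/(−t)`. -/
def WitnessVorticityBound : Prop :=
  ∀ (ν C Λ₀ : ℝ) (v : ℝ → E³ → E³) (q : ℝ → E³ → ℝ) (K : ℝ → E³ → ℝ), IsWitness ν C Λ₀ v q K →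
    ∃ C' : ℝ, ∀ t < 0, ∀ x, ‖curl (v t) x‖ ≤ C' / (-t)

/-- **Two-ended pinning.** Constant adapted frequency on the WHOLE line `(−∞,0)` plus the Type-I vorticity
bound forces the self-similar value: `H(t) = A (−t)^{−Λ₀}` and `H ≤ C′²(−t)^{−2}` at both ends `t → 0⁻`
(gives `Λ₀ ≤ 2`) and `t → −∞` (gives `Λ₀ ≥ 2`). So `Λ₀ = 2` and `H(t) = H(−1)(−t)^{−2}` exactly:
the rescaled adapted enstrophy `(−t)² H` is CONSTANT. (Real analysis once `H′ = deriv H` is known.) -/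
def TwoEndedPinning : Prop :=
  ∀ (ν C Λ₀ C' : ℝ) (v : ℝ → E³ → E³) (q : ℝ → E³ → ℝ) (K : ℝ → E³ → ℝ), IsWitness ν C Λ₀ v q K →
    (∀ t < 0, ∀ x, ‖curl (v t) x‖ ≤ C' / (-t)) →
    Λ₀ = 2 ∧ ∀ t < 0, adaptedEnstrophy v K t = adaptedEnstrophy v K (-1) * (-t) ^ (-(2 : ℝ))

/-! ### Card `moving-adjoint-bernoulli` -/

/-- **Moving-adjoint Bernoulli identity** (unsteady Tsai/NRŠ identity against the crux's OWN kernel).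
For a classical Navier–Stokes solution `(v,q)` on `(−∞,0)` and a flow-adapted backward kernel `K` of
`∂ₜ + v·∇ − νΔ` (so `d/dt ∫ f K = ∫ (∂ₜf + v·∇f − νΔf) K`), the Bernoulli head `h = ½|v|² + q` obeys
`(∂ₜ + v·∇ − νΔ) h = −ν|curl v|² + ∂ₜq` (because `Δq = −tr((∇v)²)` and `|∇v|² − tr((∇v)²) = |curl v|²`),
hence `d/dt ⟨h⟩_K = −ν H + ⟨∂ₜq⟩_K` with `H = adaptedEnstrophy v K`. Side conditions: polynomial growth of
`v, q` and the derivatives entering, against the Gaussian tails of `K`. -/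
def MovingAdjointBernoulli : Prop :=
  ∀ (ν : ℝ) (v : ℝ → E³ → E³) (q : ℝ → E³ → ℝ) (K : ℝ → E³ → ℝ), 0 < ν →
    IsClassicalNSSolutionOn (Iio 0) ν 0 v q → IsAdaptedBackwardKernel ν v (Iio 0) 0 0 K →
    IsGaussianComparable K (Iio 0) 0 0 →
    (∃ (N : ℕ) (M : ℝ → ℝ), ∀ t < 0, ∀ x,
        ‖v t x‖ + |q t x| + ‖fderiv ℝ (v t) x‖ + ‖fderiv ℝ (q t) x‖ +
          |timeDerivWithin (Iio 0) q t x| + ‖timeDerivWithin (Iio 0) v t x‖ ≤ M t * (1 + ‖x‖) ^ N) →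
    ∀ t < 0,
      HasDerivWithinAt (fun τ => ∫ x, (2⁻¹ * ‖v τ x‖ ^ 2 + q τ x) * K τ x)
        (-ν * adaptedEnstrophy v K t + ∫ x, timeDerivWithin (Iio 0) q t x * K t x) (Iio 0) t

/-- **Secular pressure-work law** (the identity integrated on a witness, after pinning `H = A(−t)⁻²`):
for `t₁ < t₂ < 0`, `∫_{t₁}^{t₂} ⟨∂ₜq⟩_K dt = ⟨h⟩_K(t₂) − ⟨h⟩_K(t₁) + ν A (1/(−t₂) − 1/(−t₁))`.
Since `(−t)⟨h⟩_K(t)` is bounded on a normalised witness, in log-time `s = −log(−t)` this says: the Cesàro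
mean of the rescaled kernel-mean pressure tendency is EXACTLY `νA > 0` at both ends `s → ±∞` — the one
number every line built on this lever has to show cannot be sustained. -/
def SecularPressureWork : Prop :=
  ∀ (ν C A : ℝ) (v : ℝ → E³ → E³) (q : ℝ → E³ → ℝ) (K : ℝ → E³ → ℝ), IsWitness ν C 2 v q K →
    (∀ t < 0, adaptedEnstrophy v K t = A * (-t) ^ (-(2 : ℝ))) →
    (∃ (N : ℕ) (M : ℝ → ℝ), ∀ t < 0, ∀ x,
        ‖v t x‖ + |q t x| + ‖fderiv ℝ (v t) x‖ + ‖fderiv ℝ (q t) x‖ +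
          |timeDerivWithin (Iio 0) q t x| + ‖timeDerivWithin (Iio 0) v t x‖ ≤ M t * (1 + ‖x‖) ^ N) →
    ∀ t₁ t₂ : ℝ, t₁ < t₂ → t₂ < 0 →
      ∫ t in t₁..t₂, (∫ x, timeDerivWithin (Iio 0) q t x * K t x) =
        (∫ x, (2⁻¹ * ‖v t₂ x‖ ^ 2 + q t₂ x) * K t₂ x) - (∫ x, (2⁻¹ * ‖v t₁ x‖ ^ 2 + q t₁ x) * K t₁ x) +
          ν * A * (1 / (-t₂) - 1 / (-t₁))

/-! ### Card `kernel-fading-memory` -/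

/-- A positive normalised `C²` solution of the adjoint equation `∂ₜK + v·∇K + νΔK = 0` on a closed time
window `[t₁, t₂]` (clauses (1)–(4) of `IsAdaptedBackwardKernel` on `Icc t₁ t₂`; no pole condition). -/
def IsWindowAdjointKernel (ν : ℝ) (v : ℝ → E³ → E³) (t₁ t₂ : ℝ) (K : ℝ → E³ → ℝ) : Prop :=
  ContDiffOn ℝ 2 (uncurry K) (Icc t₁ t₂ ×ˢ univ) ∧ (∀ t ∈ Icc t₁ t₂, ∀ x, 0 < K t x) ∧
    (∀ t ∈ Icc t₁ t₂, ∀ x,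
      timeDerivWithin (Icc t₁ t₂) K t x + fderiv ℝ (K t) x (v t x) + ν * (Laplacian.laplacian (K t)) x = 0) ∧
    (∀ t ∈ Icc t₁ t₂, ∫ x, K t x = 1)

/-- **Kernel merging (fading memory).** In log-time `σ = log(−t)` (increasing into the past) the rescaled
kernel solves the Fokker–Planck equation of `dY = −(U(Y) + ½Y) dσ + √(2ν) dB` — confining drift `−½y`
plus a bounded divergence-free perturbation — which is geometrically ergodic UNIFORMLY over the Type-I
class. Hence two window adjoint kernels of the same Type-I flow, both Gaussian-comparable at scale `√(−t)`
about `0` with the same constants, are exponentially close (in the number of e-folds `log((−t₁)/(−t₂))`)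
in `L¹` at the early end of the window, with constants depending only on `(ν, C, c₁, c₂, C₁, C₂)`. -/
def KernelMerging : Prop :=
  ∀ (ν C c₁ c₂ C₁ C₂ : ℝ), 0 < ν → 0 < c₁ → 0 < c₂ → 0 < C₁ → 0 < C₂ →
    ∃ κ M : ℝ, 0 < κ ∧ 0 < M ∧
      ∀ (v : ℝ → E³ → E³) (q : ℝ → E³ → ℝ) (K₁ K₂ : ℝ → E³ → ℝ) (t₁ t₂ : ℝ), t₁ < t₂ → t₂ < 0 →
        IsClassicalNSSolutionOn (Iio 0) ν 0 v q → HasTypeITimeDecay C v →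
        IsWindowAdjointKernel ν v t₁ t₂ K₁ → IsWindowAdjointKernel ν v t₁ t₂ K₂ →
        (∀ K ∈ ({K₁, K₂} : Set (ℝ → E³ → ℝ)), ∀ t ∈ Icc t₁ t₂, ∀ x,
            c₁ * (0 - t) ^ (-(3 : ℝ) / 2) * Real.exp (-(‖x‖ ^ 2) / (c₂ * (0 - t))) ≤ K t x ∧
              K t x ≤ C₁ * (0 - t) ^ (-(3 : ℝ) / 2) * Real.exp (-(‖x‖ ^ 2) / (C₂ * (0 - t)))) →
        ∫ x, |K₁ t₁ x - K₂ t₁ x| ≤ M * ((-t₁) / (-t₂)) ^ (-κ)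

/-- **Uniqueness of the comparable adapted kernel** (corollary of merging: let `t₂ ↑ 0` with `t₁` fixed;
no regularity at the pole is used, unlike the forward-duality proof through the critical drift). -/
def ComparableKernelUnique : Prop :=
  ∀ (ν C : ℝ) (v : ℝ → E³ → E³) (q : ℝ → E³ → ℝ) (K₁ K₂ : ℝ → E³ → ℝ), 0 < ν →
    IsClassicalNSSolutionOn (Iio 0) ν 0 v q → HasTypeITimeDecay C v →
    IsAdaptedBackwardKernel ν v (Iio 0) 0 0 K₁ → IsGaussianComparable K₁ (Iio 0) 0 0 →
    IsAdaptedBackwardKernel ν v (Iio 0) 0 0 K₂ → IsGaussianComparable K₂ (Iio 0) 0 0 →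
    ∀ t < 0, ∀ x, K₁ t x = K₂ t x

/-- **The disprover's converse (RSS ⇒ witness).** A rotated self-similar classical flow
`v = pvAnsatz α U₀` (Pineau–Vicol's (1.7), any rotation speed `α`) with the Type-I time bound, a
comparable adapted kernel and positive adapted enstrophy has CONSTANT adapted frequency `2`: by uniqueness
the kernel is covariant under the screw symmetry `(t,x) ↦ (μ²t, μ R(2α log μ) x)` of `v`, so the rescaled
adapted enstrophy is constant. Hence a nontrivial middle-`α` RSS profile (Pineau–Vicol Conj. 1.1, open for
`α ≈ 1`) with a comparable kernel refutes the crux. -/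
def RSSGivesConstantFrequency : Prop :=
  ∀ (ν α C : ℝ) (U₀ : E³ → E³) (v : ℝ → E³ → E³) (q : ℝ → E³ → ℝ) (K : ℝ → E³ → ℝ), 0 < ν →
    IsClassicalNSSolutionOn (Iio 0) ν 0 v q →
    (∀ t < 0, ∀ x, v t x = pvAnsatz α (fun y _ => U₀ y) t x) → HasTypeITimeDecay C v →
    IsAdaptedBackwardKernel ν v (Iio 0) 0 0 K → IsGaussianComparable K (Iio 0) 0 0 →
    (∀ t < 0, 0 < adaptedEnstrophy v K t) → ∀ t < 0, adaptedFrequency v K 0 t = 2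

end Summit.NavierStokesRegularity.NavierStokesRegularity.Cruxes.FrequencyRigidity
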